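import Summits.ResolutionOfSingularities.ResolutionOfSingularities.Theorems.WildConesClassicalRegimesStubMuDropCharTwoOrdPDescent
import Literature.AlgebraicGeometry.Resolution.PlaneGermBlowupCalculus

/-!
# Milnor drop in characteristic two (`stub_muDropCharTwoOrdP`) — helper 5/8: Leaves

Helper file for the stub `stub_muDropCharTwoOrdP` of crux `ClassicalRegimes`
(stmt-ResolutionOfSingularities-16884, route `WildCones`, line `milnor-descent`): the one-step drop
of the Milnor number `μ = dim_κ κ⟦u₁,…,uₙ⟧/(∂a)` of the cleaned state of `z² = a(u)` under the
point-blow-up dynamics in characteristic two, `n ≥ 3`. The proof works on formal power series: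
a hyperbolic pair `u_j u_l` of the quadratic part of `a` is split off by the formal coordinate change
`u_j ↦ q⁻¹ ∂_l a, u_l ↦ q⁻¹ ∂_j a` (formal inverse function theorem; `∂_j ∂_j = 0` in
characteristic two makes `∂_j ã ∈ (u_l)`, `∂_l ã ∈ (u_j)`), which commutes with the strict
transform; killing `u_j, u_l` descends to `n - 2` variables with the same Milnor algebras. The
leaves: `n ≥ 3` residual variables without hyperbolic pair are not isolated (Case A), `n = 1` is
`μ = ord - 1`, and `n = 2` is Max Noether's inequality `I(∂ₓa, ∂_y a) ≥ m m' + I(strict transforms)`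
at the point of the exceptional line plus the multiplicity `≤ 3` of that line in `(∂G)`.
Sources: G.-M. Greuel, G. Pfister, *The splitting lemma in any characteristic*, J. Algebra 689
(2026) = arXiv:2507.17078, Thm. 3.5 / Cor. 3.7 (the hyperbolic pair; only its linear part is used);
E. Casas-Alvero, *Singularities of Plane Curves*, §3 (Noether's formula); folklore otherwise.

This file: the leaves with `≥ 3` residual variables (Case A: not isolated) and one variable (`μ` drops by two), and the colength calculus of plane curve germs `dim κ⟦x,y⟧/(P, xH) = dim/(P, x) + dim/(P, H)` (`x ∤ P`), `dim/(x, g) = ord_y g(0,y)`.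
-/

noncomputable section

-- single-problem summit: the doubled namespace component `ResolutionOfSingularities` is forced
set_option linter.dupNamespace false

open scoped BigOperators Classical

open MvPowerSeries IsLocalRing

open Literature.AlgebraicGeometry.Resolution

namespace Summit.ResolutionOfSingularities.ResolutionOfSingularities.Theorems.WildCones

namespace MuDropCharTwoOrdP

variable {κ : Type} [Field κ]

/-! ## The leaves of the induction: three or more residual variables (Case A), and curves -/

section Leaves

variable {n : ℕ}

/-- **CASE A.** If `a` (of order `≥ 2`) has no square-free quadratic monomial and `n ≥ 3`, then a
strict transform `G` without linear terms is not isolated: `(∂G) ⊆ (X_i, ∂_i G)`. [folklore] -/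
theorem caseA_not_finite [CharP κ 2] (hn : 3 ≤ n) (i : Fin n) (τ : Fin n → κ)
    {a G : MvPowerSeries (Fin n) κ} (ha : 2 ≤ a.order)
    (hG : X i ^ 2 * G = subst (fun s => if s = i then (X i : MvPowerSeries (Fin n) κ)
      else X i * (X s + C (τ s))) a)
    (hG0 : ∀ s, coeff (Finsupp.single s 1) G = 0)
    (hnopair : ∀ j l : Fin n, j ≠ l → coeff (Finsupp.single j 1 + Finsupp.single l 1) a = 0) :
    ¬ Module.Finite κ (MvPowerSeries (Fin n) κ ⧸
      Ideal.span (Set.range fun s => MvPowerSeries.pderiv s G)) := by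
  have ha' := (FormalCoordChange.two_le_order_iff a).mp ha
  -- the partials `∂ₘ a` have order `≥ 2`
  have h2 : ∀ m, 2 ≤ (MvPowerSeries.pderiv m a).order := by
    intro m
    rw [FormalCoordChange.two_le_order_iff]
    refine ⟨by rw [constantCoeff_pderiv]; exact ha'.2 m, fun t => ?_⟩
    rw [coeff_single_pderiv]
    by_cases htm : t = m
    · rw [htm, Finsupp.single_eq_same, Nat.cast_one, CharTwo.add_self_eq_zero, zero_mul]
    · rw [hnopair t m htm, mul_zero]
  -- hence `X_i ∣ ∂ₘ G` for `m ≠ i`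
  have hdvd : ∀ m, m ≠ i → (X i : MvPowerSeries (Fin n) κ) ∣ MvPowerSeries.pderiv m G := by
    intro m hm
    obtain ⟨w, hw⟩ := X_pow_dvd_subst_blowFam i τ (d := 2) (f := MvPowerSeries.pderiv m a)
      (by exact_mod_cast h2 m)
    rw [← X_mul_pderiv_strict_of_ne i τ hm hG, pow_two, mul_assoc] at hw
    exact ⟨w, MvPowerSeries.X_mul_cancel hw⟩
  have hle : Ideal.span (Set.range fun s => MvPowerSeries.pderiv s G) ≤
      Ideal.span ((({X i, MvPowerSeries.pderiv i G} : Finset (MvPowerSeries (Fin n) κ)) :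
        Set (MvPowerSeries (Fin n) κ))) := by
    rw [Ideal.span_le]
    rintro _ ⟨s, rfl⟩
    by_cases hs : s = i
    · subst hs
      exact Ideal.subset_span (by simp)
    · obtain ⟨w, hw⟩ := hdvd s hs
      rw [SetLike.mem_coe, show (fun s => MvPowerSeries.pderiv s G) s = X i * w from hw]
      exact Ideal.mul_mem_right _ _ (Ideal.subset_span (by simp))
  refine not_finite_quot_of_le_span _ ?_ (lt_of_lt_of_le (lt_of_le_of_lt Finset.card_le_two
    (by norm_num)) hn) hle
  intro x hx
  simp only [Finset.coe_insert, Finset.coe_singleton, Set.mem_insert_iff, Set.mem_singleton_iff] at hx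
  rw [SetLike.mem_coe, Literature.RingTheory.MvPowerSeries.Jets.mem_maximalIdeal_iff_constantCoeff_eq_zero]
  rcases hx with rfl | rfl
  · exact constantCoeff_X i
  · rw [constantCoeff_pderiv]; exact hG0 i

/-- In one variable, a non-zero series is `X ^ ord` times a unit. [folklore] -/
theorem exists_eq_X_pow_mul_unit {g : MvPowerSeries (Fin 1) κ} (hg : g ≠ 0) :
    ∃ u : MvPowerSeries (Fin 1) κ, IsUnit u ∧ g = X 0 ^ g.order.toNat * u := by
  have finOne_eq_single : ∀ m : Fin 1 →₀ ℕ, m = Finsupp.single 0 (m 0) := fun m =>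
    Finsupp.ext fun s => by fin_cases s; simp
  set k := g.order.toNat with hk
  have hord : g.order = (k : ℕ∞) := (ne_zero_iff_order_finite.mp hg).symm
  have hdvd : (X 0 : MvPowerSeries (Fin 1) κ) ^ k ∣ g := by
    rw [X_pow_dvd_iff]
    intro m hm
    apply coeff_of_lt_order
    rw [hord, Nat.cast_lt, finOne_eq_single m, Finsupp.degree_single]
    exact hm
  obtain ⟨u, hu⟩ := hdvd
  refine ⟨u, ?_, hu⟩
  obtain ⟨m₀, hm₀, hdeg⟩ := exists_coeff_ne_zero_and_order hord.symm
  rw [finOne_eq_single m₀, Finsupp.degree_single] at hdeg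
  rw [isUnit_iff_constantCoeff, ← coeff_zero_eq_constantCoeff_apply]
  have hm0 : m₀ 0 = k := by
    have : ((m₀ 0 : ℕ) : ℕ∞) = (k : ℕ∞) := by rw [hdeg, ← hord]
    exact_mod_cast this
  rw [finOne_eq_single m₀, hm0, hu, X_pow_eq, coeff_monomial_mul, if_pos le_rfl, one_mul,
    tsub_self] at hm₀
  exact isUnit_iff_ne_zero.mpr hm₀

/-- In one variable, `κ⟦X⟧ ⧸ (X ^ k)` is finite of dimension `k`. [folklore] -/
theorem finrank_quot_X_pow (k : ℕ) :
    Module.Finite κ (MvPowerSeries (Fin 1) κ ⧸ Ideal.span {(X 0 : MvPowerSeries (Fin 1) κ) ^ k}) ∧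
      Module.finrank κ (MvPowerSeries (Fin 1) κ ⧸ Ideal.span {(X 0 : MvPowerSeries (Fin 1) κ) ^ k}) = k := by
  have finOne_eq_single : ∀ m : Fin 1 →₀ ℕ, m = Finsupp.single 0 (m 0) := fun m =>
    Finsupp.ext fun s => by fin_cases s; simp
  set L : MvPowerSeries (Fin 1) κ →ₗ[κ] (Fin k → κ) :=
    LinearMap.pi fun j : Fin k => coeff (Finsupp.single 0 (j : ℕ)) with hL
  have hLapp : ∀ f j, L f j = coeff (Finsupp.single 0 (j : ℕ)) f := fun f j => rfl
  have hsurj : Function.Surjective L := by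
    intro v
    refine ⟨fun m => if h : m 0 < k then v ⟨m 0, h⟩ else 0, funext fun j => ?_⟩
    rw [hLapp, show coeff (Finsupp.single (0 : Fin 1) (j : ℕ))
      ((fun m : Fin 1 →₀ ℕ => if h : m 0 < k then v ⟨m 0, h⟩ else 0) : MvPowerSeries (Fin 1) κ) =
      if h : (Finsupp.single (0 : Fin 1) (j : ℕ)) 0 < k then v ⟨(Finsupp.single (0 : Fin 1) (j : ℕ)) 0, h⟩
      else 0 from rfl]
    simp [j.2]
  have hker : LinearMap.ker L = (Ideal.span {(X 0 : MvPowerSeries (Fin 1) κ) ^ k}).restrictScalars κ := by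
    ext f
    rw [LinearMap.mem_ker, Submodule.restrictScalars_mem, Ideal.mem_span_singleton, X_pow_dvd_iff]
    constructor
    · intro h m hm
      have := congrFun h ⟨m 0, hm⟩
      rw [hLapp, Pi.zero_apply] at this
      rwa [finOne_eq_single m]
    · intro h
      funext j
      rw [hLapp, Pi.zero_apply]
      exact h _ (by rw [Finsupp.single_eq_same]; exact j.2)
  have e1 := (Submodule.quotEquivOfEq _ _ hker).symm.trans (L.quotKerEquivOfSurjective hsurj)
  have e2 := Submodule.Quotient.restrictScalarsEquiv κ
    ((Ideal.span {(X 0 : MvPowerSeries (Fin 1) κ) ^ k}).restrictScalars κ)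
  -- `e2 : (R ⧸ (I.restrictScalars κ).restrictScalars κ) ≃ R ⧸ I.restrictScalars κ`; combine
  have e := (Submodule.Quotient.restrictScalarsEquiv κ
    (Ideal.span {(X 0 : MvPowerSeries (Fin 1) κ) ^ k})).symm.trans e1
  exact ⟨Module.Finite.equiv e.symm, by rw [e.finrank_eq, Module.finrank_fintype_fun_eq_card,
    Fintype.card_fin]⟩

/-- In one variable, `κ⟦X⟧ ⧸ (g)` for `g ≠ 0` is finite of dimension `ord g`. [folklore] -/
theorem finrank_quot_span_singleton {g : MvPowerSeries (Fin 1) κ} (hg : g ≠ 0) :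
    Module.Finite κ (MvPowerSeries (Fin 1) κ ⧸ Ideal.span {g}) ∧
      Module.finrank κ (MvPowerSeries (Fin 1) κ ⧸ Ideal.span {g}) = g.order.toNat := by
  obtain ⟨u, hu, hgu⟩ := exists_eq_X_pow_mul_unit hg
  have : Ideal.span {g} = Ideal.span {(X 0 : MvPowerSeries (Fin 1) κ) ^ g.order.toNat} := by
    conv_lhs => rw [hgu]
    exact Ideal.span_singleton_mul_right_unit hu _
  rw [this]
  exact finrank_quot_X_pow _

/-- **THE CURVE LEAF.** In one variable the Milnor number drops (by two) under a step:
`X² G = a` gives `∂a = X² ∂G`. [folklore] -/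
theorem curve_drop [CharP κ 2] (i : Fin 1) (τ : Fin 1 → κ) {a G : MvPowerSeries (Fin 1) κ}
    (hG : X i ^ 2 * G = subst (fun s => if s = i then (X i : MvPowerSeries (Fin 1) κ)
      else X i * (X s + C (τ s))) a)
    (hfin : Module.Finite κ (MvPowerSeries (Fin 1) κ ⧸
      Ideal.span (Set.range fun s => MvPowerSeries.pderiv s G))) :
    Module.finrank κ (MvPowerSeries (Fin 1) κ ⧸ Ideal.span (Set.range fun s => MvPowerSeries.pderiv s G)) <
      Module.finrank κ (MvPowerSeries (Fin 1) κ ⧸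
        Ideal.span (Set.range fun s => MvPowerSeries.pderiv s a)) := by
  have hi : i = 0 := Subsingleton.elim _ _
  subst hi
  have hφ : (fun s => if s = (0 : Fin 1) then (X 0 : MvPowerSeries (Fin 1) κ)
      else X 0 * (X s + C (τ s))) = X := by
    funext s; rw [Subsingleton.elim s 0, if_pos rfl]
  rw [hφ, subst_self, id] at hG
  have hrange : ∀ f : MvPowerSeries (Fin 1) κ, (Set.range fun s => MvPowerSeries.pderiv s f) =
      {MvPowerSeries.pderiv 0 f} := by
    intro f
    ext x
    simp only [Set.mem_range, Set.mem_singleton_iff]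
    exact ⟨fun ⟨s, hs⟩ => by rw [← hs, Subsingleton.elim s 0], fun h => ⟨0, h.symm⟩⟩
  rw [hrange, hrange] at *
  have hda : MvPowerSeries.pderiv 0 a = X 0 ^ 2 * MvPowerSeries.pderiv 0 G := by
    rw [← hG, pderiv_X_sq_mul]
  -- `∂G ≠ 0` by finiteness
  have hg : MvPowerSeries.pderiv 0 G ≠ 0 := by
    intro h0
    rw [h0, Ideal.span_singleton_zero] at hfin
    refine not_finite_quot_span (n := 1) (κ := κ) ∅ (by simp) (by simp) ?_
    rwa [Finset.coe_empty, Ideal.span_empty]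
  obtain ⟨u, hu, hgu⟩ := exists_eq_X_pow_mul_unit hg
  set ν := (MvPowerSeries.pderiv 0 G).order.toNat with hν
  have h1 : Ideal.span {MvPowerSeries.pderiv 0 G} = Ideal.span {(X 0 : MvPowerSeries (Fin 1) κ) ^ ν} := by
    conv_lhs => rw [hgu]
    exact Ideal.span_singleton_mul_right_unit hu _
  have h2 : Ideal.span {MvPowerSeries.pderiv 0 a} =
      Ideal.span {(X 0 : MvPowerSeries (Fin 1) κ) ^ (ν + 2)} := by
    rw [hda, hgu, ← mul_assoc, ← pow_add, add_comm]
    exact Ideal.span_singleton_mul_right_unit hu _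
  rw [h1, h2, (finrank_quot_X_pow ν).2, (finrank_quot_X_pow (ν + 2)).2]
  omega

end Leaves


/-! ## Plane curve germs: colengths `dim κ⟦x,y⟧/(P, Q)` -/

section Plane

/-- ADDITIVITY OF COLENGTHS: `dim S/(P, x H) = dim S/(P, x) + dim S/(P, H)` when `x ∤ P`
(`S = κ⟦x, y⟧`, `x = X 0`); all three are finite as soon as the first is. [folklore] -/
theorem colength_X_mul {P H : MvPowerSeries (Fin 2) κ} (hP : ¬ (X 0 : MvPowerSeries (Fin 2) κ) ∣ P)
    (hfin : Module.Finite κ (MvPowerSeries (Fin 2) κ ⧸ Ideal.span {P, X 0 * H})) :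
    Module.Finite κ (MvPowerSeries (Fin 2) κ ⧸ Ideal.span {P, (X 0 : MvPowerSeries (Fin 2) κ)}) ∧
    Module.Finite κ (MvPowerSeries (Fin 2) κ ⧸ Ideal.span {P, H}) ∧
    Module.finrank κ (MvPowerSeries (Fin 2) κ ⧸ Ideal.span {P, X 0 * H}) =
      Module.finrank κ (MvPowerSeries (Fin 2) κ ⧸ Ideal.span {P, (X 0 : MvPowerSeries (Fin 2) κ)}) +
      Module.finrank κ (MvPowerSeries (Fin 2) κ ⧸ Ideal.span {P, H}) := by
  set I₁ : Ideal (MvPowerSeries (Fin 2) κ) := Ideal.span {P, X 0 * H} with hI₁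
  set I₂ : Ideal (MvPowerSeries (Fin 2) κ) := Ideal.span {P, (X 0 : MvPowerSeries (Fin 2) κ)} with hI₂
  set I₃ : Ideal (MvPowerSeries (Fin 2) κ) := Ideal.span {P, H} with hI₃
  have hP1 : P ∈ I₁ := Ideal.subset_span (by simp)
  have hP2 : P ∈ I₂ := Ideal.subset_span (by simp)
  have hP3 : P ∈ I₃ := Ideal.subset_span (by simp)
  have hxH1 : X 0 * H ∈ I₁ := Ideal.subset_span (by simp)
  have hx2 : (X 0 : MvPowerSeries (Fin 2) κ) ∈ I₂ := Ideal.subset_span (by simp)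
  have hH3 : H ∈ I₃ := Ideal.subset_span (by simp)
  have h12 : I₁ ≤ I₂ := by
    rw [hI₁, Ideal.span_le]
    intro z hz
    simp only [Set.mem_insert_iff, Set.mem_singleton_iff] at hz
    rcases hz with rfl | rfl
    · exact hP2
    · exact Ideal.mul_mem_right _ _ hx2
  have h13 : I₁ ≤ I₃ := by
    rw [hI₁, Ideal.span_le]
    intro z hz
    simp only [Set.mem_insert_iff, Set.mem_singleton_iff] at hz
    rcases hz with rfl | rfl
    · exact hP3
    · exact Ideal.mul_mem_left _ _ hH3
  haveI := hfin
  have hfin2 : Module.Finite κ (MvPowerSeries (Fin 2) κ ⧸ I₂) := finite_quot_mono h12 hfin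
  have hfin3 : Module.Finite κ (MvPowerSeries (Fin 2) κ ⧸ I₃) := finite_quot_mono h13 hfin
  refine ⟨hfin2, hfin3, ?_⟩
  -- multiplication by `x` : `S/I₃ → S/I₁`, and the projection `S/I₁ → S/I₂`
  let ψ : (MvPowerSeries (Fin 2) κ ⧸ I₃) →ₗ[κ] (MvPowerSeries (Fin 2) κ ⧸ I₁) :=
    Submodule.mapQ (I₃.restrictScalars κ) (I₁.restrictScalars κ)
      (LinearMap.mulLeft κ (X 0 : MvPowerSeries (Fin 2) κ)) (by
        rw [hI₃]
        intro z hz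
        rw [Submodule.restrictScalars_mem, Ideal.mem_span_pair] at hz
        obtain ⟨c, d, rfl⟩ := hz
        rw [Submodule.mem_comap, LinearMap.mulLeft_apply, Submodule.restrictScalars_mem, mul_add,
          ← mul_assoc, mul_left_comm]
        exact I₁.add_mem (I₁.mul_mem_left _ hP1) (I₁.mul_mem_left _ hxH1))
  have h12' : I₁.restrictScalars κ ≤ I₂.restrictScalars κ := fun z hz => h12 hz
  let π : (MvPowerSeries (Fin 2) κ ⧸ I₁) →ₗ[κ] (MvPowerSeries (Fin 2) κ ⧸ I₂) :=
    Submodule.mapQ (I₁.restrictScalars κ) (I₂.restrictScalars κ) LinearMap.id h12'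
  have hψ : ∀ z, ψ (Submodule.Quotient.mk z) = Submodule.Quotient.mk (X 0 * z) := fun z =>
    Submodule.mapQ_apply _ _ _ z
  have hπ : ∀ z, π (Submodule.Quotient.mk z) = Submodule.Quotient.mk z := fun z =>
    Submodule.mapQ_apply _ _ _ z
  -- `ψ` is injective
  have hinj : Function.Injective ψ := by
    rw [← LinearMap.ker_eq_bot, LinearMap.ker_eq_bot']
    intro z hz
    obtain ⟨z, rfl⟩ := Submodule.Quotient.mk_surjective _ z
    rw [hψ, Submodule.Quotient.mk_eq_zero, hI₁, Ideal.mem_span_pair] at hz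
    obtain ⟨c, d, hcd⟩ := hz
    have hx : (X 0 : MvPowerSeries (Fin 2) κ) ∣ c * P := ⟨z - d * H, by rw [mul_sub, ← hcd]; ring⟩
    rcases (PlaneGerm.prime_X 0).dvd_or_dvd hx with hc | hc
    · obtain ⟨c', rfl⟩ := hc
      have : z = c' * P + d * H := by
        apply MvPowerSeries.X_mul_cancel (i := (0 : Fin 2))
        rw [← hcd]; ring
      rw [Submodule.Quotient.mk_eq_zero, this]
      exact I₃.add_mem (I₃.mul_mem_left _ hP3) (I₃.mul_mem_left _ hH3)
    · exact absurd hc hP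
  -- `π` is surjective
  have hsurj : Function.Surjective π := by
    intro z
    obtain ⟨z, rfl⟩ := Submodule.Quotient.mk_surjective _ z
    exact ⟨Submodule.Quotient.mk z, rfl⟩
  -- exactness in the middle
  have hexact : LinearMap.ker π = LinearMap.range ψ := by
    ext z
    obtain ⟨z, rfl⟩ := Submodule.Quotient.mk_surjective _ z
    rw [LinearMap.mem_ker, hπ, Submodule.Quotient.mk_eq_zero, LinearMap.mem_range]
    constructor
    · intro hz
      rw [hI₂, Ideal.mem_span_pair] at hz
      obtain ⟨c, d, rfl⟩ := hz
      refine ⟨Submodule.Quotient.mk d, ?_⟩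
      rw [hψ, Submodule.Quotient.eq]
      have : X 0 * d - (c * P + d * X 0) = -(c * P) := by ring
      rw [this]
      exact I₁.neg_mem (I₁.mul_mem_left _ hP1)
    · rintro ⟨w, hw⟩
      obtain ⟨w, rfl⟩ := Submodule.Quotient.mk_surjective _ w
      rw [hψ, Submodule.Quotient.eq] at hw
      have : z = X 0 * w - (X 0 * w - z) := by ring
      rw [this]
      exact I₂.sub_mem (I₂.mul_mem_right _ hx2) (h12 hw)
  have h1 := LinearMap.finrank_range_add_finrank_ker π
  rw [LinearMap.range_eq_top.mpr hsurj, finrank_top, hexact,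
    LinearEquiv.finrank_eq (LinearEquiv.ofInjective ψ hinj).symm] at h1
  omega

/-- Iterated additivity: `dim S/(P, x^e H) = e · dim S/(P, x) + dim S/(P, H)` when `x ∤ P`.
[folklore] -/
theorem colength_X_pow_mul {P H : MvPowerSeries (Fin 2) κ} (hP : ¬ (X 0 : MvPowerSeries (Fin 2) κ) ∣ P)
    (e : ℕ) (hfin : Module.Finite κ (MvPowerSeries (Fin 2) κ ⧸ Ideal.span {P, X 0 ^ e * H})) :
    Module.Finite κ (MvPowerSeries (Fin 2) κ ⧸ Ideal.span {P, H}) ∧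
    Module.finrank κ (MvPowerSeries (Fin 2) κ ⧸ Ideal.span {P, X 0 ^ e * H}) =
      e * Module.finrank κ (MvPowerSeries (Fin 2) κ ⧸ Ideal.span {P, (X 0 : MvPowerSeries (Fin 2) κ)}) +
      Module.finrank κ (MvPowerSeries (Fin 2) κ ⧸ Ideal.span {P, H}) := by
  induction e generalizing H with
  | zero =>
    rw [pow_zero, one_mul] at hfin ⊢
    exact ⟨hfin, by rw [zero_mul, zero_add]⟩
  | succ e ih =>
    rw [pow_succ', mul_assoc] at hfin ⊢
    obtain ⟨_, h2, h3⟩ := colength_X_mul hP hfin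
    obtain ⟨h4, h5⟩ := ih h2
    exact ⟨h4, by rw [h3, h5]; ring⟩

/-- The embedding of the `y`-axis variable. [folklore] -/
theorem range_axisEmb : ∀ s : Fin 2, s ∈ Set.range (⟨fun _ => (1 : Fin 2), fun a b _ =>
    Subsingleton.elim a b⟩ : Fin 1 ↪ Fin 2) ↔ s ≠ 0 ∧ s ≠ 0 := by
  intro s
  constructor
  · rintro ⟨t, rfl⟩
    exact ⟨show (1 : Fin 2) ≠ 0 by decide, show (1 : Fin 2) ≠ 0 by decide⟩
  · intro hs
    refine ⟨0, ?_⟩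
    fin_cases s
    · exact absurd rfl hs.1
    · rfl

/-- THE COLENGTH OF `(x, g)`: it is the `y`-order of `g(0, y)`. [folklore] -/
theorem colength_X_eq_order {g : MvPowerSeries (Fin 2) κ}
    (hg : killCompl (⟨fun _ => (1 : Fin 2), fun a b _ => Subsingleton.elim a b⟩ : Fin 1 ↪ Fin 2) g ≠ 0) :
    Module.Finite κ (MvPowerSeries (Fin 2) κ ⧸ Ideal.span {(X 0 : MvPowerSeries (Fin 2) κ), g}) ∧
    Module.finrank κ (MvPowerSeries (Fin 2) κ ⧸ Ideal.span {(X 0 : MvPowerSeries (Fin 2) κ), g}) =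
      (killCompl (⟨fun _ => (1 : Fin 2), fun a b _ => Subsingleton.elim a b⟩ : Fin 1 ↪ Fin 2) g).order.toNat := by
  set e : Fin 1 ↪ Fin 2 := ⟨fun _ => (1 : Fin 2), fun a b _ => Subsingleton.elim a b⟩ with he
  have hker : RingHom.ker (killCompl (R := κ) e : MvPowerSeries (Fin 2) κ →+* MvPowerSeries (Fin 1) κ) ≤
      Ideal.span {(X 0 : MvPowerSeries (Fin 2) κ), g} := by
    refine (ker_killCompl_le e range_axisEmb).trans ?_
    rw [Ideal.span_le]
    intro z hz
    simp only [Set.mem_insert_iff, Set.mem_singleton_iff, or_self] at hz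
    subst hz
    exact Ideal.subset_span (by simp)
  obtain ⟨h⟩ := @exists_quot_equiv_of_surjective κ _ (MvPowerSeries (Fin 2) κ)
    (MvPowerSeries (Fin 1) κ) _ _ _ _ (killCompl (R := κ) e) (killCompl_surjective e) _ hker
  have hmap : (Ideal.span {(X 0 : MvPowerSeries (Fin 2) κ), g}).map
      (killCompl (R := κ) e : MvPowerSeries (Fin 2) κ →+* MvPowerSeries (Fin 1) κ) =
      Ideal.span {killCompl e g} := by
    rw [Ideal.map_span, Set.image_insert_eq, Set.image_singleton]
    change Ideal.span {killCompl e (X 0), killCompl e g} = _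
    rw [killCompl_X_eq_zero (fun h => (range_axisEmb 0 |>.mp h).1 rfl), Ideal.span_insert_zero]
  have h' := h.trans (Ideal.quotientEquivAlgOfEq κ hmap)
  obtain ⟨hf, hr⟩ := finrank_quot_span_singleton hg
  exact ⟨Module.Finite.equiv h'.symm.toLinearEquiv, by rw [h'.toLinearEquiv.finrank_eq, hr]⟩

/-- Coefficients on the `y`-axis. [folklore] -/
theorem coeff_killCompl_axis (g : MvPowerSeries (Fin 2) κ) (k : ℕ) :
    coeff (Finsupp.single 0 k) (killCompl (⟨fun _ => (1 : Fin 2), fun a b _ =>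
      Subsingleton.elim a b⟩ : Fin 1 ↪ Fin 2) g) = coeff (Finsupp.single 1 k) g := by
  rw [coeff_killCompl, Finsupp.embDomain_single]
  rfl

end Plane

end MuDropCharTwoOrdP

end Summit.ResolutionOfSingularities.ResolutionOfSingularities.Theorems.WildCones

end
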